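import Summits.PneNP.PneNP.Theses.RamseyUncertifiable

/-!
# Sketch — first lemmas of the three crux idea cards for `SosUncertainty` (stmt-PneNP-9815)

Ideator 3, round 1. Signatures only need to ELABORATE; proofs are not claimed here
(`sorry`), except where marked provable-now in the cards.
-/

namespace Summit.PneNP.PneNP.Cruxes.SosUncertainty.Sketch

open Literature.Combinatorics.SimpleGraph Finset
open Summit.PneNP.PneNP.Theses.RamseyUncertifiable

/-! ## Card `polar-bessel-defect` -/

/-- The WEIGHTED POLAR form of UP_t (card 1, transfer C⁺): if degree-2t Lasserre certifies
`w(S) ≤ 1` on (pseudo-)stable sets of `G` and `w'(K) ≤ 1` on (pseudo-)cliques of `G`, then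
`⟨w, w'⟩ ≤ n^γ` with `γ < 1`.  Level 1 is Bessel's inequality for `u_v ⊗ v_v` (γ = 0). -/
def WeightedPolarUP : Prop :=
  ∀ t : ℕ, 1 ≤ t → ∃ γ : ℝ, γ < 1 ∧ ∃ n₀ : ℕ, ∀ n ≥ n₀, ∀ G : SimpleGraph (Fin n),
    ∀ w w' : Fin n → ℝ, (∀ v, 0 ≤ w v) → (∀ v, 0 ≤ w' v) →
      (∀ y : Finset (Fin n) → ℝ, IsLasserreFeasible G t y → ∑ v, w v * y {v} ≤ 1) →
      (∀ z : Finset (Fin n) → ℝ, IsLasserreFeasible Gᶜ t z → ∑ v, w' v * z {v} ≤ 1) →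
        ∑ v, w v * w' v ≤ (n : ℝ) ^ γ

/-- First lemma of card 1 (provable now: take `w = 𝟙/las_t(G)`, `w' = 𝟙/las_t(Ḡ)`). -/
theorem sosUncertainty_of_weightedPolarUP : WeightedPolarUP → SosUncertainty := by
  intro h t ht
  obtain ⟨γ, hγ, n₀, hn⟩ := h t ht
  refine ⟨1 - γ, by linarith, max n₀ 1, ?_⟩
  intro n hn' G
  have hn₀ : n₀ ≤ n := le_trans (le_max_left _ _) hn'
  have hn1 : 1 ≤ n := le_trans (le_max_right _ _) hn'
  have hnpos : (0 : ℝ) < n := by exact_mod_cast hn1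
  -- `las_t ≥ 1` on both sides: a single vertex is a stable set
  have hone : ∀ H : SimpleGraph (Fin n), (1 : ℝ) ≤ lasserreStableBound H t := by
    intro H
    have hind : H.IsNIndepSet 1 ({(⟨0, hn1⟩ : Fin n)} : Finset (Fin n)) :=
      ⟨by rw [Finset.coe_singleton]; exact Set.pairwise_singleton _ _, by simp⟩
    exact_mod_cast le_lasserreStableBound_of_isNIndepSet H t hind ht
  set a := lasserreStableBound G t with ha_def
  set b := lasserreStableBound Gᶜ t with hb_def
  have hapos : 0 < a := by linarith [hone G]
  have hbpos : 0 < b := by linarith [hone Gᶜ]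
  have key := hn n hn₀ G (fun _ => 1 / a) (fun _ => 1 / b)
    (fun _ => by positivity) (fun _ => by positivity)
    (by
      intro y hy
      show ∑ v, 1 / a * y {v} ≤ 1
      rw [← Finset.mul_sum, div_mul_eq_mul_div, one_mul, div_le_one hapos]
      exact hy.sum_singleton_le_lasserreStableBound ht)
    (by
      intro z hz
      show ∑ v, 1 / b * z {v} ≤ 1
      rw [← Finset.mul_sum, div_mul_eq_mul_div, one_mul, div_le_one hbpos]
      exact hz.sum_singleton_le_lasserreStableBound ht)
  have hsum : ∑ _v : Fin n, (fun _ : Fin n => 1 / a) _v * (fun _ : Fin n => 1 / b) _v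
      = (n : ℝ) / (a * b) := by
    simp only [Finset.sum_const, Finset.card_univ, Fintype.card_fin, nsmul_eq_mul]
    field_simp
  rw [hsum] at key
  have hγpos : (0 : ℝ) < (n : ℝ) ^ γ := Real.rpow_pos_of_pos hnpos γ
  have hab : 0 < a * b := mul_pos hapos hbpos
  rw [div_le_iff₀ hab] at key
  rw [Real.rpow_sub hnpos, Real.rpow_one, div_le_iff₀ hγpos]
  calc (n : ℝ) ≤ (n : ℝ) ^ γ * (a * b) := key
    _ = a * b * (n : ℝ) ^ γ := by ring

/-- The weak inclusion `LAS_t(Ḡ) ⊆ abl(LAS_t(G))` (card 1, sanity direction; via level 1 and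
theta antiblocking): pseudo-stable and pseudo-clique marginals have inner product ≤ 1. -/
theorem sum_mul_le_one_of_feasible (t : ℕ) (ht : 1 ≤ t) {n : ℕ} (G : SimpleGraph (Fin n))
    (y z : Finset (Fin n) → ℝ) (hy : IsLasserreFeasible G t y) (hz : IsLasserreFeasible Gᶜ t z) :
    ∑ v, y {v} * z {v} ≤ 1 := by
  sorry

/-! ## Card `same-field-tensor-modp` -/

/-- The Frankl–Wilson graph `FW_p`: vertices the `(p²−1)`-subsets of `[p³]`, `A ~ B` iff
`|A ∩ B| ≡ −1 (mod p)` (Frankl–Wilson 1981; Alon 1998, Remark after Thm 1.1). -/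
def fwGraph (p : ℕ) : SimpleGraph {A : Finset (Fin (p ^ 3)) // A.card = p ^ 2 - 1} :=
  SimpleGraph.fromRel fun A B => (A.1 ∩ B.1).card % p = p - 1

/-- First lemma / first target of card 2: UP_t ON the Frankl–Wilson family (the crux's named
falsifier family), uniformly in `p` at fixed level `t`. -/
def FWUncertainty : Prop :=
  ∀ t : ℕ, 1 ≤ t → ∃ δ : ℝ, 0 < δ ∧ ∃ p₀ : ℕ, ∀ p ≥ p₀, p.Prime →
    (((p ^ 3).choose (p ^ 2 - 1) : ℕ) : ℝ) ^ δ ≤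
      lasserreStableBound (fwGraph p) t * lasserreStableBound (fwGraph p)ᶜ t

/-- Sanity: `SosUncertainty` implies `FWUncertainty` once `las_t` is transported along the
relabelling `{A // |A| = p²−1} ≃ Fin (choose …)` (iso-invariance of `las_t`, routine). -/
theorem fwUncertainty_of_sosUncertainty : SosUncertainty → FWUncertainty := by
  sorry

/-! ## Card `forster-latent-regime` -/

/-- First lemma of card 3 (provable now, classical): `m` unit vectors in `ℝ^d` with pairwise
NEGATIVE inner products number at most `d + 1`; hence the independence number of the random
geometric graph `G(n, d, ½)` (adjacent iff `⟨x_u, x_v⟩ ≥ 0`) is at most `d + 1`, deterministically. -/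
theorem card_le_succ_of_pairwise_inner_neg (d m : ℕ) (x : Fin m → Fin d → ℝ)
    (hunit : ∀ i, ∑ k, x i k * x i k = 1)
    (hobtuse : ∀ i j, i ≠ j → ∑ k, x i k * x j k < 0) : m ≤ d + 1 := by
  sorry

/-- Forster's inequality as a named-fact SHAPE (to be vendored under Literature/): an `m × m`
sign matrix realised by unit vectors in `ℝ^d` (`M_{ij} = sign ⟨x_i, y_j⟩`, all inner products
nonzero) has operator norm at least `m / d` — stated here through the quadratic form:
some unit test vectors `a, b` achieve `aᵀ M b ≥ m / d`. [Forster 2002, main theorem ⇒ ‖M‖ ≥ m/rank] -/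
def ForsterNormBound : Prop :=
  ∀ d m : ℕ, 0 < d → 0 < m → ∀ x y : Fin m → Fin d → ℝ,
    (∀ i j, ∑ k, x i k * y j k ≠ 0) →
      ∃ a b : Fin m → ℝ, ∑ i, a i ^ 2 = 1 ∧ ∑ j, b j ^ 2 = 1 ∧
        (m : ℝ) / d ≤ ∑ i, ∑ j, a i * (if 0 < ∑ k, x i k * y j k then (1 : ℝ) else -1) * b j

end Summit.PneNP.PneNP.Cruxes.SosUncertainty.Sketch
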